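import Literature.Probability.LatticeModels.MedialPolygonWinding
import Literature.Topology.PlaneTopology.RectilinearUmlaufsatz

/-!
# Simple rectilinear lattice loops: the right winding number is constant; the moves of the Umlaufsatz preserve it
(line `qkz-strip-boundary-arm` of crux `CardyComplexCone.EdgePrecompact`, stmt-CriticalPhenomena-11387;
first file of the proof of the OPEN-ARC HOPF FORMULA for the oriented medial graph — the planar input of
the START-pair residual shared by `ufrs_initialContactCase_certJ` and `ufrs_slippedReturnCase_certJ` —
whose inductive step needs Hopf's Umlaufsatz WITH THE SIGN OF THE WINDING NUMBER for the simple
rectilinear bigons cut out by two medial arcs)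

For a rectilinear lattice loop `l` (`RectLoop.IsLoop`: at least three pairwise distinct points of `ℤ²`,
cyclically adjacent — a simple closed unit-step polygon, straight vertices allowed; its cyclic steps
`cdarts l` are unit steps, each occurring once and never reversed) and the combinatorial winding number
`MedialTrail.wnd l` (`MedialTrailUmlaufsatz.lean`, jumps for unit-step polygons in
`MedialPolygonWinding.lean`):

* `simpleLoop_wnd_lf_ST`: across every step the winding number drops by one from left to right;
* `simpleLoop_wnd_rf_eq_ST` / `simpleLoop_wnd_rf_const_ST` (registered): **the right winding number is
  constant along the loop** — around a vertex passed once it jumps by `1` across the incoming and the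
  outgoing step and not at all across the two other unit steps at that vertex (twelve local cases);
* `wnd_rf_flip_ST`, `wnd_rf_fwd_ST`, `wnd_rf_bwd_ST`: the three moves of the tree's rectilinear
  Umlaufsatz (`RectilinearLoopMoves.lean`: flip of a corner of type `{e₀, -e₁}` to the free opposite cell
  corner, forward / backward shortcut of a unit bump) change the loop by the boundary of ONE unit cell `Q`,
  at which the winding number changes by `±1`; since `Q` is the left face of an old step and the right face
  of a new one (or vice versa), the right winding number of the new loop equals that of the old one;
* `cross_eq_turn_ST`: the quarter turn `RectLoop.cross` of two unit steps is `MedialTrail.turn`;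
  `dartWnd_north_ST` & co.: winding contributions of explicit steps.

The next file runs the induction of `RectLoop.IsLoop.cycTurn_eq` with this invariant and proves
`cycTurn l = 4 + 8 · wnd l (rf d)` (counter-clockwise loops have the interior on their left).

References: H. Hopf, Compositio Math. 2 (1935), Satz I; folklore (orthogonal polygons).
-/

set_option linter.unusedSimpArgs false

namespace Summit.CriticalPhenomena.CardyFormulaZ2.Cruxes.EdgePrecompact.QkzStripBoundaryArm

open Literature.Probability.LatticeModels Literature.Probability.LatticeModels.MedialTrail
open Literature.Topology.PlaneTopology Literature.Topology.PlaneTopology.RectLoop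
open List

/-! ## Unit steps, darts of a loop -/

/-- `RectLoop.Adj` is `MedialTrail.IsUnitStep`. -/
theorem adj_iff_isUnitStep_ST (p q : ℤ × ℤ) : Adj p q ↔ IsUnitStep p q := by
  obtain ⟨a, b⟩ := p; obtain ⟨c, d⟩ := q
  constructor
  · rintro ⟨i, hi⟩
    fin_cases i <;> simp [dir, Prod.ext_iff] at hi <;> simp only [IsUnitStep] <;> omega
  · intro h
    simp only [IsUnitStep] at h
    rcases h with ⟨h1, h2 | h2⟩ | ⟨h1, h2 | h2⟩
    · exact ⟨1, by simp [dir, Prod.ext_iff]; omega⟩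
    · exact ⟨3, by simp [dir, Prod.ext_iff]; omega⟩
    · exact ⟨0, by simp [dir, Prod.ext_iff]; omega⟩
    · exact ⟨2, by simp [dir, Prod.ext_iff]; omega⟩

/-- The quarter turn of two consecutive unit steps: `RectLoop.cross` is `MedialTrail.turn`. -/
theorem cross_eq_turn_ST {u v w : ℤ × ℤ} (h1 : IsUnitStep u v) (h2 : IsUnitStep v w) :
    cross (v - u) (w - v) = turn u v w := by
  obtain ⟨a, b⟩ := u; obtain ⟨c, d⟩ := v; obtain ⟨e, f⟩ := w
  simp only [IsUnitStep] at h1 h2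
  rcases h1 with ⟨rfl, rfl | rfl⟩ | ⟨rfl, rfl | rfl⟩ <;> rcases h2 with ⟨rfl, rfl | rfl⟩ | ⟨rfl, rfl | rfl⟩ <;>
    simp [cross, turn]

/-- Winding contribution of a north step. -/
theorem dartWnd_north_ST (a b x y : ℤ) : dartWnd ((a, b), (a, b + 1)) (x, y) = if a ≤ x ∧ y = b then -1 else 0 := by
  show (if a = a ∧ b + 1 = b + 1 ∧ a ≤ x ∧ y = b then (-1 : ℤ)
    else if a = a ∧ b + 1 = b - 1 ∧ a ≤ x ∧ y = b + 1 then 1 else 0) = _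
  split_ifs <;> omega

/-- Winding contribution of a north step written from its head. -/
theorem dartWnd_north'_ST (a b x y : ℤ) : dartWnd ((a, b - 1), (a, b)) (x, y) = if a ≤ x ∧ y = b - 1 then -1 else 0 := by
  have := dartWnd_north_ST a (b - 1) x y
  rwa [sub_add_cancel] at this

/-- Winding contribution of a south step. -/
theorem dartWnd_south_ST (a b x y : ℤ) : dartWnd ((a, b), (a, b - 1)) (x, y) = if a ≤ x ∧ y = b - 1 then 1 else 0 := by
  show (if a = a ∧ b - 1 = b + 1 ∧ a ≤ x ∧ y = b then (-1 : ℤ)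
    else if a = a ∧ b - 1 = b - 1 ∧ a ≤ x ∧ y = b - 1 then 1 else 0) = _
  split_ifs <;> omega

/-- A horizontal step does not contribute. -/
theorem dartWnd_horiz_ST (a b a' : ℤ) (F : Pt) : dartWnd ((a, b), (a', b)) F = 0 := by
  obtain ⟨x, y⟩ := F
  simp only [dartWnd]
  split_ifs with h1 h2 <;> omega

section Loop

variable {l : List (ℤ × ℤ)}

/-- The cyclic steps of a loop are unit steps. -/
theorem isUnitStep_of_mem_cdarts_ST (hl : IsLoop l) {d : Pt × Pt} (hd : d ∈ cdarts l) :
    IsUnitStep d.1 d.2 := by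
  obtain ⟨i, hi, rfl⟩ := mem_cdarts_iff.1 hd
  have hc := hl.chain
  rw [List.isChain_iff_getElem] at hc
  have hlen : (l ++ l.take 1).length = l.length + 1 := by
    have := hl.three_le; simp [List.length_take]; omega
  have key := hc i (by rw [hlen]; omega)
  rw [adj_iff_isUnitStep_ST] at key
  have e1 : (l ++ l.take 1)[i]'(by rw [hlen]; omega) = l[i] := List.getElem_append_left hi
  have e2 : (l ++ l.take 1)[i + 1]'(by rw [hlen]; omega) = l[(i + 1) % l.length]'(Nat.mod_lt _ (by omega)) := by
    rcases Nat.lt_or_ge (i + 1) l.length with h | h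
    · rw [List.getElem_append_left h]; congr 1; exact (Nat.mod_eq_of_lt h).symm
    · have hi1 : i + 1 = l.length := by omega
      rw [List.getElem_append_right (by omega)]
      simp only [List.getElem_take, hi1, Nat.sub_self, Nat.mod_self]
  rw [e1, e2] at key
  exact key

/-- The cyclic steps of a loop are pairwise distinct. -/
theorem nodup_cdarts_ST (hl : IsLoop l) : (cdarts l).Nodup := by
  have h : (cdarts l).map Prod.fst = l := by
    rw [cdarts, List.map_fst_zip]; simp
  have hn := hl.nodup
  rw [← h] at hn
  exact hn.of_map _

/-- A step of a loop occurs once. -/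
theorem count_eq_one_ST (hl : IsLoop l) {d : Pt × Pt} (hd : d ∈ cdarts l) : (cdarts l).count d = 1 :=
  List.count_eq_one_of_mem (nodup_cdarts_ST hl) hd

/-- The only step out of a vertex is the loop's step. -/
theorem count_out_ST (hl : IsLoop l) {v w z : Pt} (hw : (v, w) ∈ cdarts l) (hz : z ≠ w) :
    (cdarts l).count (v, z) = 0 :=
  List.count_eq_zero.2 fun h => hz (cdarts_succ_unique hl.nodup h hw)

/-- The only step into a vertex is the loop's step. -/
theorem count_in_ST (hl : IsLoop l) {u v z : Pt} (hu : (u, v) ∈ cdarts l) (hz : z ≠ u) :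
    (cdarts l).count (z, v) = 0 :=
  List.count_eq_zero.2 fun h => hz (cdarts_pred_unique hl.nodup h hu)

/-- A loop never traverses a step back and forth. -/
theorem swap_not_mem_cdarts_ST (hl : IsLoop l) {u v : Pt} (h : (u, v) ∈ cdarts l) : (v, u) ∉ cdarts l := by
  intro h'
  have h2 : 2 ≤ l.length := by have := hl.three_le; omega
  obtain ⟨k, M, hk, hrot⟩ := exists_rotate_eq_cons_cons h2 h
  have hl' : IsLoop (l.rotate k) := hl.rotate k
  rw [hrot] at hl'
  have h3 : M ≠ [] := by
    intro hM; subst hM; have := hl'.three_le; simp at this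
  obtain ⟨w, M', rfl⟩ := List.exists_cons_of_ne_nil h3
  -- the step after `v` in the rotated list is `(v, w)`, hence `w = u`: but `u` heads the list
  have hvw : (v, w) ∈ cdarts (u :: v :: w :: M') := by
    rw [cdarts_cons_cons]; simp [pdarts]
  have hvu : (v, u) ∈ cdarts (u :: v :: w :: M') := by
    rw [← hrot, cdarts_rotate]; exact List.mem_rotate.2 h'
  have := cdarts_succ_unique hl'.nodup hvw hvu
  subst this
  have := hl'.nodup
  simp at this

/-- Jump across a step of the loop: `wnd (lf d) = wnd (rf d) + 1`. -/
theorem simpleLoop_wnd_lf_ST (hl : IsLoop l) {d : Pt × Pt} (hd : d ∈ cdarts l) :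
    wnd l (lf d) = wnd l (rf d) + 1 := by
  refine wnd_lf_of_count_eq_one (fun e he => isUnitStep_of_mem_cdarts_ST hl he)
    (isUnitStep_of_mem_cdarts_ST hl hd) (count_eq_one_ST hl hd) ?_
  obtain ⟨u, v⟩ := d
  exact List.count_eq_zero.2 (swap_not_mem_cdarts_ST hl hd)

/-- No jump across a unit step at a vertex of the loop that is neither the incoming nor the outgoing step. -/
theorem wnd_lf_eq_rf_other_ST (hl : IsLoop l) {u v w z : Pt} (hu : (u, v) ∈ cdarts l) (hw : (v, w) ∈ cdarts l)
    (hzw : z ≠ w) (hzu : z ≠ u) (hvz : IsUnitStep v z) : wnd l (lf (v, z)) = wnd l (rf (v, z)) :=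
  wnd_lf_eq_rf_of_count_eq_zero (fun _ he => isUnitStep_of_mem_cdarts_ST hl he) hvz
    (count_out_ST hl hw hzw) (count_in_ST hl hu hzu)

/-- **The right winding number is constant along a simple loop** (two consecutive steps). At the vertex
`v` the loop occupies the incoming and the outgoing step only; going around `v` the winding number jumps
by `1` across each of them and not at all across the two other unit steps at `v`. -/
theorem simpleLoop_wnd_rf_consec_ST (hl : IsLoop l) {u v w : Pt} (hu : (u, v) ∈ cdarts l)
    (hw : (v, w) ∈ cdarts l) : wnd l (rf (u, v)) = wnd l (rf (v, w)) := by
  have huw : u ≠ w := fun h => swap_not_mem_cdarts_ST hl hu (h ▸ hw)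
  have J1 := simpleLoop_wnd_lf_ST hl hu
  have J2 := simpleLoop_wnd_lf_ST hl hw
  have J3 := fun z => wnd_lf_eq_rf_other_ST hl hu hw (z := z)
  have hsw := isUnitStep_of_mem_cdarts_ST hl hw
  obtain ⟨c, e⟩ := w
  obtain ⟨a, b, h | h | h | h⟩ := (isUnitStep_of_mem_cdarts_ST hl hu).cases <;>
    rw [Prod.mk.injEq] at h <;> obtain ⟨rfl, rfl⟩ := h <;>
    simp only [IsUnitStep] at hsw <;> simp only [ne_eq, Prod.mk.injEq, not_and] at huw
  · -- incoming step north, `v = (a, b + 1)`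
    rw [lf_north, rf_north] at J1; rw [rf_north]
    have N := J3 (a, b + 1 + 1); have S := J3 (a, b + 1 - 1); have Ea := J3 (a + 1, b + 1); have We := J3 (a - 1, b + 1)
    simp only [IsUnitStep, true_and, and_true, true_or, or_true, ne_eq, forall_true_left, Prod.mk.injEq,
      lf_north, rf_north, lf_south, rf_south, lf_east, rf_east, lf_west, rf_west, add_sub_cancel_right] at N S Ea We
    rcases hsw with ⟨hc, he | he⟩ | ⟨he, hc | hc⟩ <;> subst hc <;> subst he
    · rw [lf_north] at J2; rw [rf_north] at J2 ⊢; try (have := Ea (by omega) (by omega); have := We (by omega) (by omega); omega)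
    · exfalso; exact huw rfl (by omega)
    · rw [lf_east] at J2; rw [rf_east] at J2 ⊢; try (have := N (by omega) (by omega); have := We (by omega) (by omega); omega)
    · rw [lf_west] at J2; rw [rf_west] at J2 ⊢; try (have := N (by omega) (by omega); have := Ea (by omega) (by omega); omega)
  · -- incoming step south, `v = (a, b - 1)`
    rw [lf_south, rf_south] at J1; rw [rf_south]
    have N := J3 (a, b - 1 + 1); have S := J3 (a, b - 1 - 1); have Ea := J3 (a + 1, b - 1); have We := J3 (a - 1, b - 1)
    simp only [IsUnitStep, true_and, and_true, true_or, or_true, ne_eq, forall_true_left, Prod.mk.injEq,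
      lf_north, rf_north, lf_south, rf_south, lf_east, rf_east, lf_west, rf_west, sub_add_cancel] at N S Ea We
    rcases hsw with ⟨hc, he | he⟩ | ⟨he, hc | hc⟩ <;> subst hc <;> subst he
    · exfalso; exact huw rfl (by omega)
    · rw [lf_south] at J2; rw [rf_south] at J2 ⊢; try (have := Ea (by omega) (by omega); have := We (by omega) (by omega); omega)
    · rw [lf_east] at J2; rw [rf_east] at J2 ⊢; try (have := S (by omega) (by omega); have := We (by omega) (by omega); omega)
    · rw [lf_west] at J2; rw [rf_west] at J2 ⊢
  · -- incoming step east, `v = (a + 1, b)`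
    rw [lf_east, rf_east] at J1; rw [rf_east]
    have N := J3 (a + 1, b + 1); have S := J3 (a + 1, b - 1); have Ea := J3 (a + 1 + 1, b); have We := J3 (a + 1 - 1, b)
    simp only [IsUnitStep, true_and, and_true, true_or, or_true, ne_eq, forall_true_left, Prod.mk.injEq,
      lf_north, rf_north, lf_south, rf_south, lf_east, rf_east, lf_west, rf_west, add_sub_cancel_right] at N S Ea We
    rcases hsw with ⟨hc, he | he⟩ | ⟨he, hc | hc⟩ <;> subst hc <;> subst he
    · rw [lf_north] at J2; rw [rf_north] at J2 ⊢; try (have := S (by omega) (by omega); have := Ea (by omega) (by omega); omega)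
    · rw [lf_south] at J2; rw [rf_south] at J2 ⊢; try (have := N (by omega) (by omega); have := Ea (by omega) (by omega); omega)
    · rw [lf_east] at J2; rw [rf_east] at J2 ⊢; try (have := N (by omega) (by omega); have := S (by omega) (by omega); omega)
    · exfalso; exact huw (by omega) rfl
  · -- incoming step west, `v = (a - 1, b)`
    rw [lf_west, rf_west] at J1; rw [rf_west]
    have N := J3 (a - 1, b + 1); have S := J3 (a - 1, b - 1); have Ea := J3 (a - 1 + 1, b); have We := J3 (a - 1 - 1, b)
    simp only [IsUnitStep, true_and, and_true, true_or, or_true, ne_eq, forall_true_left, Prod.mk.injEq,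
      lf_north, rf_north, lf_south, rf_south, lf_east, rf_east, lf_west, rf_west, sub_add_cancel] at N S Ea We
    rcases hsw with ⟨hc, he | he⟩ | ⟨he, hc | hc⟩ <;> subst hc <;> subst he
    · rw [lf_north] at J2; rw [rf_north] at J2 ⊢
    · rw [lf_south] at J2; rw [rf_south] at J2 ⊢; try (have := N (by omega) (by omega); have := We (by omega) (by omega); omega)
    · exfalso; exact huw (by omega) rfl
    · rw [lf_west] at J2; rw [rf_west] at J2 ⊢; try (have := N (by omega) (by omega); have := S (by omega) (by omega); omega)

/-- **The right winding number is constant along a simple loop.** -/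
theorem simpleLoop_wnd_rf_eq_ST (hl : IsLoop l) {d d' : Pt × Pt} (hd : d ∈ cdarts l) (hd' : d' ∈ cdarts l) :
    wnd l (rf d) = wnd l (rf d') := by
  have h3 := hl.three_le
  have key : ∀ (i : ℕ) (hi : i < l.length),
      wnd l (rf (l[i], l[(i + 1) % l.length]'(Nat.mod_lt _ (by omega)))) =
        wnd l (rf (l[0], l[(0 + 1) % l.length]'(Nat.mod_lt _ (by omega)))) := by
    intro i
    induction i with
    | zero => intro hi; rfl
    | succ i ih =>
      intro hi
      rw [← ih (by omega)]
      have hm1 : (l[i], l[(i + 1) % l.length]'(Nat.mod_lt _ (by omega))) ∈ cdarts l := mem_cdarts_iff.2 ⟨i, by omega, rfl⟩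
      have hm2 : (l[i + 1], l[(i + 1 + 1) % l.length]'(Nat.mod_lt _ (by omega))) ∈ cdarts l :=
        mem_cdarts_iff.2 ⟨i + 1, hi, rfl⟩
      have e : (i + 1) % l.length = i + 1 := Nat.mod_eq_of_lt hi
      simp only [e] at hm1 ⊢
      exact (simpleLoop_wnd_rf_consec_ST hl hm1 hm2).symm
  obtain ⟨i, hi, rfl⟩ := mem_cdarts_iff.1 hd
  obtain ⟨j, hj, rfl⟩ := mem_cdarts_iff.1 hd'
  exact (key i hi).trans (key j hj).symm

/-- **The right winding number is constant along a simple rectilinear lattice loop** (registered helper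
`simpleLoop_wnd_rf_const_ST` of stmt-CriticalPhenomena-11387; explicit form of `simpleLoop_wnd_rf_eq_ST`). -/
theorem simpleLoop_wnd_rf_const_ST : ∀ (l : List (ℤ × ℤ)) (d d' : (ℤ × ℤ) × (ℤ × ℤ)), Literature.Topology.PlaneTopology.RectLoop.IsLoop l → d ∈ MedialTrail.cdarts l → d' ∈ MedialTrail.cdarts l → MedialTrail.wnd l (MedialTrail.rf d) = MedialTrail.wnd l (MedialTrail.rf d') :=
  fun _ _ _ hl hd hd' => simpleLoop_wnd_rf_eq_ST hl hd hd'

end Loop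

/-! ## Winding numbers of lists with explicit head vertices -/

/-- Winding number of a list with two explicit head vertices: the first step separated. -/
theorem wnd_cons_cons_ST (a b : Pt) (M : List Pt) (F : Pt) :
    wnd (a :: b :: M) F = dartWnd (a, b) F + dwnd (pdarts (b :: M) ++ [((b :: M).getLast (List.cons_ne_nil _ _), a)]) F := by
  rw [wnd, cdarts_cons_cons]
  simp only [dwnd, List.map_cons, List.map_append, List.sum_cons, List.sum_append, List.cons_append]

/-- Peeling a second explicit step. -/
theorem dwnd_pdarts_cons_cons_ST (b c : Pt) (M : List Pt) (a F : Pt) :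
    dwnd (pdarts (b :: c :: M) ++ [((b :: c :: M).getLast (List.cons_ne_nil _ _), a)]) F =
      dartWnd (b, c) F + dwnd (pdarts (c :: M) ++ [((c :: M).getLast (List.cons_ne_nil _ _), a)]) F := by
  have e : (b :: c :: M).getLast (List.cons_ne_nil _ _) = (c :: M).getLast (List.cons_ne_nil _ _) :=
    List.getLast_cons (List.cons_ne_nil _ _)
  rw [e]
  simp only [pdarts, dwnd, List.map_cons, List.map_append, List.sum_cons, List.sum_append, List.cons_append]
  try ring

/-! ## The moves: the right winding number of the new loop is that of the old one -/

section Moves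

variable {x₀ x₁ v x₃ x₄ z : ℤ × ℤ} {R : List (ℤ × ℤ)}

/-- In a loop with five explicit vertices, `(x₁, v)` is a step. -/
theorem mem_cdarts_window_ST (x₀ x₁ v x₃ x₄ : ℤ × ℤ) (R : List (ℤ × ℤ)) :
    (x₁, v) ∈ cdarts (x₀ :: x₁ :: v :: x₃ :: x₄ :: R) := by
  rw [cdarts_cons_cons]; simp [pdarts]

/-- In a loop with three explicit vertices, `(x₁, y)` is a step. -/
theorem mem_cdarts_window3_ST (x₀ x₁ y : ℤ × ℤ) (R : List (ℤ × ℤ)) :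
    (x₁, y) ∈ cdarts (x₀ :: x₁ :: y :: R) := by
  rw [cdarts_cons_cons]; simp [pdarts]

/-- The two corner configurations of the walk, in coordinates. -/
theorem corner_coords_ST {p q : ℤ} (h13 : (x₁ = (p, q) + dir 0 ∧ x₃ = (p, q) + dir 3) ∨ (x₁ = (p, q) + dir 3 ∧ x₃ = (p, q) + dir 0)) :
    (x₁ = (p + 1, q) ∧ x₃ = (p, q - 1) ∧ x₁ + x₃ - (p, q) = (p + 1, q - 1)) ∨
      (x₁ = (p, q - 1) ∧ x₃ = (p + 1, q) ∧ x₁ + x₃ - (p, q) = (p + 1, q - 1)) := by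
  rcases h13 with ⟨e1, e3⟩ | ⟨e1, e3⟩ <;> subst e1 <;> subst e3
  · left; refine ⟨?_, ?_, ?_⟩ <;> ext <;> simp [dir] <;> ring
  · right; refine ⟨?_, ?_, ?_⟩ <;> ext <;> simp [dir] <;> ring

/-- **Flip**: the right winding number at the new step `(x₁, v')` is the old one at `(x₁, v)`. -/
theorem wnd_rf_flip_ST (h : IsLoop (x₀ :: x₁ :: v :: x₃ :: x₄ :: R)) (h' : IsLoop (x₀ :: x₁ :: (x₁ + x₃ - v) :: x₃ :: x₄ :: R))
    (h13 : (x₁ = v + dir 0 ∧ x₃ = v + dir 3) ∨ (x₁ = v + dir 3 ∧ x₃ = v + dir 0)) :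
    wnd (x₀ :: x₁ :: (x₁ + x₃ - v) :: x₃ :: x₄ :: R) (rf (x₁, x₁ + x₃ - v)) =
      wnd (x₀ :: x₁ :: v :: x₃ :: x₄ :: R) (rf (x₁, v)) := by
  have J := simpleLoop_wnd_lf_ST h (mem_cdarts_window_ST x₀ x₁ v x₃ x₄ R)
  have J' := simpleLoop_wnd_lf_ST h' (mem_cdarts_window_ST x₀ x₁ (x₁ + x₃ - v) x₃ x₄ R)
  obtain ⟨p, q⟩ := v
  rcases corner_coords_ST h13 with ⟨e1, e3, e'⟩ | ⟨e1, e3, e'⟩ <;> rw [e'] at J' ⊢ <;> subst e1 <;> subst e3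
  · -- `x₁` east of `v`: the old step `(x₁, v)` is west (left face `Q`), the new step is south (right face `Q`)
    have d : wnd (x₀ :: (p + 1, q) :: (p, q) :: (p, q - 1) :: x₄ :: R) (p, q - 1) =
        wnd (x₀ :: (p + 1, q) :: (p + 1, q - 1) :: (p, q - 1) :: x₄ :: R) (p, q - 1) + 1 := by
      rw [wnd_cons_cons_ST, wnd_cons_cons_ST, dwnd_pdarts_cons_cons_ST (p + 1, q) (p, q),
        dwnd_pdarts_cons_cons_ST (p, q) (p, q - 1), dwnd_pdarts_cons_cons_ST (p + 1, q) (p + 1, q - 1),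
        dwnd_pdarts_cons_cons_ST (p + 1, q - 1) (p, q - 1), dartWnd_horiz_ST (p + 1) q, dartWnd_south_ST,
        dartWnd_south_ST, dartWnd_horiz_ST (p + 1) (q - 1)]
      split_ifs <;> omega
    rw [show ((p + 1, q), (p, q)) = ((p + 1, q), (p + 1 - 1, q)) by simp] at J ⊢
    rw [lf_west] at J; rw [rf_west] at J ⊢; rw [rf_south]
    simp only [add_sub_cancel_right] at J ⊢
    omega
  · -- `x₁` south of `v`: the old step is north (right face `Q`), the new step is east (left face `Q`)
    have d : wnd (x₀ :: (p, q - 1) :: (p, q) :: (p + 1, q) :: x₄ :: R) (p, q - 1) + 1 =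
        wnd (x₀ :: (p, q - 1) :: (p + 1, q - 1) :: (p + 1, q) :: x₄ :: R) (p, q - 1) := by
      rw [wnd_cons_cons_ST, wnd_cons_cons_ST, dwnd_pdarts_cons_cons_ST (p, q - 1) (p, q),
        dwnd_pdarts_cons_cons_ST (p, q) (p + 1, q), dwnd_pdarts_cons_cons_ST (p, q - 1) (p + 1, q - 1),
        dwnd_pdarts_cons_cons_ST (p + 1, q - 1) (p + 1, q), dartWnd_north'_ST, dartWnd_horiz_ST p q,
        dartWnd_horiz_ST p (q - 1), dartWnd_north'_ST]
      split_ifs <;> omega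
    rw [show ((p, q - 1), (p, q)) = ((p, q - 1), (p, q - 1 + 1)) by simp, rf_north]
    rw [lf_east] at J'
    omega

/-- **Forward shortcut**: the right winding number at the new step `(x₁, x₄)` is the old one at `(x₁, v)`. -/
theorem wnd_rf_fwd_ST (h : IsLoop (x₀ :: x₁ :: v :: x₃ :: x₄ :: R)) (h' : IsLoop (x₀ :: x₁ :: x₄ :: R))
    (h13 : (x₁ = v + dir 0 ∧ x₃ = v + dir 3) ∨ (x₁ = v + dir 3 ∧ x₃ = v + dir 0)) (hv' : x₁ + x₃ - v = x₄) :
    wnd (x₀ :: x₁ :: x₄ :: R) (rf (x₁, x₄)) = wnd (x₀ :: x₁ :: v :: x₃ :: x₄ :: R) (rf (x₁, v)) := by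
  have J := simpleLoop_wnd_lf_ST h (mem_cdarts_window_ST x₀ x₁ v x₃ x₄ R)
  have J' := simpleLoop_wnd_lf_ST h' (mem_cdarts_window3_ST x₀ x₁ x₄ R)
  obtain ⟨p, q⟩ := v
  rcases corner_coords_ST h13 with ⟨e1, e3, e'⟩ | ⟨e1, e3, e'⟩ <;> rw [e'] at hv' <;> subst e1 <;> subst e3 <;> subst hv'
  · have d : wnd (x₀ :: (p + 1, q) :: (p, q) :: (p, q - 1) :: (p + 1, q - 1) :: R) (p, q - 1) =
        wnd (x₀ :: (p + 1, q) :: (p + 1, q - 1) :: R) (p, q - 1) + 1 := by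
      rw [wnd_cons_cons_ST, wnd_cons_cons_ST, dwnd_pdarts_cons_cons_ST (p + 1, q) (p, q),
        dwnd_pdarts_cons_cons_ST (p, q) (p, q - 1), dwnd_pdarts_cons_cons_ST (p, q - 1) (p + 1, q - 1),
        dwnd_pdarts_cons_cons_ST (p + 1, q) (p + 1, q - 1), dartWnd_horiz_ST (p + 1) q, dartWnd_south_ST,
        dartWnd_horiz_ST p (q - 1), dartWnd_south_ST]
      split_ifs <;> omega
    rw [show ((p + 1, q), (p, q)) = ((p + 1, q), (p + 1 - 1, q)) by simp] at J ⊢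
    rw [lf_west] at J; rw [rf_west] at J ⊢; rw [rf_south]
    simp only [add_sub_cancel_right] at J ⊢
    omega
  · have d : wnd (x₀ :: (p, q - 1) :: (p, q) :: (p + 1, q) :: (p + 1, q - 1) :: R) (p, q - 1) + 1 =
        wnd (x₀ :: (p, q - 1) :: (p + 1, q - 1) :: R) (p, q - 1) := by
      rw [wnd_cons_cons_ST, wnd_cons_cons_ST, dwnd_pdarts_cons_cons_ST (p, q - 1) (p, q),
        dwnd_pdarts_cons_cons_ST (p, q) (p + 1, q), dwnd_pdarts_cons_cons_ST (p + 1, q) (p + 1, q - 1),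
        dwnd_pdarts_cons_cons_ST (p, q - 1) (p + 1, q - 1), dartWnd_north'_ST, dartWnd_horiz_ST p q,
        dartWnd_south_ST, dartWnd_horiz_ST p (q - 1)]
      split_ifs <;> omega
    rw [show ((p, q - 1), (p, q)) = ((p, q - 1), (p, q - 1 + 1)) by simp, rf_north]
    rw [lf_east] at J'
    omega

/-- **Backward shortcut**: the right winding number at the new step `(x₀, x₃)` is the old one at `(x₁, v)`. -/
theorem wnd_rf_bwd_ST (h : IsLoop (z :: x₀ :: x₁ :: v :: x₃ :: R)) (h' : IsLoop (z :: x₀ :: x₃ :: R))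
    (h13 : (x₁ = v + dir 0 ∧ x₃ = v + dir 3) ∨ (x₁ = v + dir 3 ∧ x₃ = v + dir 0)) (hv' : x₁ + x₃ - v = x₀) :
    wnd (z :: x₀ :: x₃ :: R) (rf (x₀, x₃)) = wnd (z :: x₀ :: x₁ :: v :: x₃ :: R) (rf (x₁, v)) := by
  have J : wnd (z :: x₀ :: x₁ :: v :: x₃ :: R) (lf (x₁, v)) = wnd (z :: x₀ :: x₁ :: v :: x₃ :: R) (rf (x₁, v)) + 1 := by
    apply simpleLoop_wnd_lf_ST h
    rw [cdarts_cons_cons]; simp [pdarts]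
  have J' := simpleLoop_wnd_lf_ST h' (mem_cdarts_window3_ST z x₀ x₃ R)
  obtain ⟨p, q⟩ := v
  rcases corner_coords_ST h13 with ⟨e1, e3, e'⟩ | ⟨e1, e3, e'⟩ <;> rw [e'] at hv' <;> subst e1 <;> subst e3 <;> subst hv'
  · have d : wnd (z :: (p + 1, q - 1) :: (p + 1, q) :: (p, q) :: (p, q - 1) :: R) (p, q - 1) =
        wnd (z :: (p + 1, q - 1) :: (p, q - 1) :: R) (p, q - 1) + 1 := by
      rw [wnd_cons_cons_ST, wnd_cons_cons_ST, dwnd_pdarts_cons_cons_ST (p + 1, q - 1) (p + 1, q),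
        dwnd_pdarts_cons_cons_ST (p + 1, q) (p, q), dwnd_pdarts_cons_cons_ST (p, q) (p, q - 1),
        dwnd_pdarts_cons_cons_ST (p + 1, q - 1) (p, q - 1), dartWnd_north'_ST, dartWnd_horiz_ST (p + 1) q,
        dartWnd_south_ST, dartWnd_horiz_ST (p + 1) (q - 1)]
      split_ifs <;> omega
    rw [show ((p + 1, q), (p, q)) = ((p + 1, q), (p + 1 - 1, q)) by simp] at J ⊢
    rw [lf_west] at J; rw [rf_west] at J ⊢
    rw [show ((p + 1, q - 1), (p, q - 1)) = ((p + 1, q - 1), (p + 1 - 1, q - 1)) by simp, rf_west]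
    simp only [add_sub_cancel_right] at J ⊢
    omega
  · have d : wnd (z :: (p + 1, q - 1) :: (p, q - 1) :: (p, q) :: (p + 1, q) :: R) (p, q - 1) + 1 =
        wnd (z :: (p + 1, q - 1) :: (p + 1, q) :: R) (p, q - 1) := by
      rw [wnd_cons_cons_ST, wnd_cons_cons_ST, dwnd_pdarts_cons_cons_ST (p + 1, q - 1) (p, q - 1),
        dwnd_pdarts_cons_cons_ST (p, q - 1) (p, q), dwnd_pdarts_cons_cons_ST (p, q) (p + 1, q),
        dwnd_pdarts_cons_cons_ST (p + 1, q - 1) (p + 1, q), dartWnd_horiz_ST (p + 1) (q - 1), dartWnd_north'_ST,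
        dartWnd_horiz_ST p q, dartWnd_north'_ST]
      split_ifs <;> omega
    rw [show ((p, q - 1), (p, q)) = ((p, q - 1), (p, q - 1 + 1)) by simp, rf_north]
    rw [show ((p + 1, q - 1), (p + 1, q)) = ((p + 1, q - 1), (p + 1, q - 1 + 1)) by simp] at J' ⊢
    rw [lf_north] at J'; rw [rf_north] at J' ⊢
    simp only [add_sub_cancel_right] at J'
    omega

end Moves

end Summit.CriticalPhenomena.CardyFormulaZ2.Cruxes.EdgePrecompact.QkzStripBoundaryArm
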